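import Mathlib
import HarnessLib
import Summits.ValiantsHypothesis.ValiantsHypothesis.Theorems.KPlusLogSqLawWeakLiftingTowerGraftRankOneGraft
import Summits.ValiantsHypothesis.ValiantsHypothesis.Theorems.KPlusLogSqLawWeakLiftingTowerGraftInflectionLaw

/-!
# Tower graft line — THE FAR EXPONENT IS FREE AFTER TWO ROLLE STEPS (II): the corner graft `det (G + a·X^D·E₀₀)`
# (the object of S4b `stub_graftLawCorner`) in pencil form and class form, and the reduction offered to the line

Mechanism file for LINE (B) `Cruxes/WeakLifting/Lines/tower_graft.lean` (crux `WeakLifting` = stmt-ValiantsHypothesis-19561;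
rung S4b `TowerGraftLawCorner`).  NO stub is claimed.  Part I (`…TowerGraftInflectionLaw`) proved, for ALL real polynomials `A, E`,
every coupling `a` and EVERY exponent `D`, `Z₊(A + a·X^D·E) ≤ Z₊(𝓘(A,E)) + 4·Z₊(A) + 2·Z₊(E) + 2` with the `D`-free
INFLECTION POLYNOMIAL `𝓘(A,E) = W(A·E, X·W(E,A))` (`W` = Mathlib's `Polynomial.wronskian`).  Here:

* `card_posRoots_cornerGraft_le_inflection` — for EVERY square matrix `G` over `ℝ[X]` of size `m+1` (no pencil structure, no
  symmetry, no steepness), every `D` and every `a`: `Z₊(det (G + a X^D·E₀₀)) ≤ Z₊(𝓘(det G, det G₀₀)) + 4·Z₊(det G) + 2·Z₊(det G₀₀) + 2`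
  (`det (G + g E₀₀) = det G + g·det G₀₀`, the tree's `det_add_smul_single_zero`).
* `card_posRoots_cornerGraft_le_inflection_class` — CLASS FORM: on any support `d` with `K ≥ 1` letters and the class budget
  `PosRootLawOn (m+1) K B d`, for every symmetric pencil `G = Σₗ X^{dₗ} Sₗ` of size `m+1`, EVERY far exponent `D` and EVERY coupling
  `a`: `Z₊(det (G + a X^D·E₀₀)) ≤ Z₊(𝓘(det G, det G₀₀)) + 6·B + 2` — NO tower hypothesis, NO `D > m·max d`, NO additive term in `m`.
  Compare the tree's `card_posRoots_rankOneGraft_le` (`≤ 2B + B' + 1`, `B'` the class budget at size `2m+1`, ONE Rolle–Schur step whose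
  residual still carries the level `D`): the second Rolle step trades `B'` for the `D`-FREE inflection count of the pair
  `(det G, det G₀₀)` — a quantity of the `K`-letter pencil alone.
* `sup_D_cornerGraft_finite` — for each fixed matrix the corner-graft counts over all `(D, a)` are BOUNDED (consistent with the tower
  floor families `…TowerRowTwoK5Family` / `…K6Family`: `ζ₊ ≥ 13 / 16` for all `D ≥ D₀`).
* `rankOneGraft_of_inflectionClassLaw` / `cornerGraft_of_inflectionClassLaw` — THE REDUCTION OFFERED TO THE LINE: an «INFLECTION
  CLASS LAW» `Z₊(𝓘(det G, det G₀₀)) ≤ 2^c·B + 2^{c·⌊log₂(m+1)⌋²}` for symmetric `(m+1)`-pencils under the class budget (a statement about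
  `K`-letter pencils — no graft, no far letter, no far exponent) implies the RANK-ONE graft law (every far letter `a·X^D·w wᵀ`: the bodies
  of S4b `TowerGraftLawCorner`, `w = eᵢ`, and of (GL-rk1) `TowerGraftLawRankOne`) with constant `c + 3`, for all sizes `m + 1 ≥ 2`,
  uniformly in `D` and `a` (so a fortiori under the tower / `D > m·max d` guards, which are not used; a constant frame `T w = (w·w)e₀` of
  the tree's `RolleSchur.exists_frame` / `frame_conj_rankOneGraft` moves the letter to the corner `0`; `inflection_constants` is the
  arithmetic).  Whether the inflection class law holds is OPEN; the tree's corner phantoms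
  (`…TowerGraftCornerPhantoms`: `2K − 3` positive zeros with `Z₊(det G) = Z₊(det G₀₀) = 0` at `m+1 = 2`; `…SkewBlockCornerGraftSharp`:
  `Θ(m²)` at every far exponent) are, by Part I, all paid by `Z₊(𝓘)` — so `𝓘` is NOT small instance-wise and the law can only hold in
  class currency, exactly like S4b itself.

* (rev 2, §5) `cornerGraft_le_of_inflectionBound_at` / `rankOneGraft_le_of_inflectionBound_at` — FORMAT-LOCAL form: the inflection
  bound for the symmetric pencils of ONE format `(m+1, K)`, ONE support `d`, ONE budget `B` already gives the rank-one graft law there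
  (S4b needs the inflection class law only on the tower supports it quantifies over, size by size).

HONEST FRAMING: Rolle bookkeeping; nothing here proves S4 (`TowerGraftLawId`), S4b (`TowerGraftLawCorner`), S4d/S4f, S5 (`TowerGraftLaw`),
S5ᴸ, TowerB, `WeakLifting`, Conjecture B, `MatrixDescartes` (18050) or anything about `VP ≠ VNP`.  Def-free; Mathlib + the tree's
`…TowerGraftRankOneGraft` (corner determinant identity, minor budget) and Part I.  Seat: prover leafhand-val-kpluslogsqlaw-1 g8,
`--supports stmt-ValiantsHypothesis-19561 --as helper`.  [folklore: Rolle / Wronskian counting; the packaging for the line is this work]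
-/

-- `Summit.ValiantsHypothesis.ValiantsHypothesis.…` repeats a component by the D-0017 layout
-- (single-conjunct summit), which the `dupNamespace` linter flags; the name is mandated.
set_option linter.dupNamespace false
set_option autoImplicit false

namespace Summit.ValiantsHypothesis.ValiantsHypothesis.Theorems.KPlusLogSqLaw.TowerGraft

open Polynomial Finset
open scoped BigOperators Polynomial Matrix
open Summit.ValiantsHypothesis.ValiantsHypothesis.Theorems.LacunarySymmetroidMatrixDescartes (PosRootLawOn)

namespace InflectionLaw

/-! ## §2b The inflection polynomial in log-Wronskian form: `X·𝓘(A,E) = 𝒲(A)·E² − 𝒲(E)·A²` -/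

/-- **log-Wronskian form of the inflection polynomial.**  With the tree's log-Wronskian `𝒲(P) = P·θ(θP) − (θP)²`, `θ = X·d/dX`
(`…ProductPlusOneCrossingInterlace`), `X·W(A·E, X·W(E,A)) = 𝒲(A)·E² − 𝒲(E)·A²`: off the zeros of `A·E` the inflection polynomial is
`(A E)²·X·(θ² log|A| − θ² log|E|)/X²`-proportional, i.e. it vanishes exactly where the log–log plots of `|A|` and `|E|` have equal curvature.
[this work] -/
theorem X_mul_inflection_eq (A E : ℝ[X]) :
    X * wronskian (A * E) (X * wronskian E A) =
      (A * (X * derivative (X * derivative A)) - (X * derivative A) ^ 2) * E ^ 2 -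
        (E * (X * derivative (X * derivative E)) - (X * derivative E) ^ 2) * A ^ 2 := by
  simp only [wronskian, derivative_mul, derivative_X, derivative_sub, one_mul]
  ring

/-! ## §3 The corner graft `det (G + a·X^D·E₀₀) = det G + a X^D·det G₀₀` (S4b's object), pencil form and class form -/

section Corner

variable {m : ℕ}

/-- ★ **CORNER GRAFT, INFLECTION FORM** — for EVERY square matrix `G` over `ℝ[X]` of size `m+1`, every exponent `D` and every
coupling `a` (no pencil structure, no symmetry, no steepness):
`Z₊(det (G + a X^D·E₀₀)) ≤ Z₊(𝓘(det G, det G₀₀)) + 4·Z₊(det G) + 2·Z₊(det G₀₀) + 2`,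
`𝓘(A,E) = W(A·E, X·W(E,A))`, `G₀₀ = G.submatrix succ succ`. [this work] -/
theorem card_posRoots_cornerGraft_le_inflection (G : Matrix (Fin (m + 1)) (Fin (m + 1)) ℝ[X]) (a : ℝ) (D : ℕ) :
    ((G + ((X : ℝ[X]) ^ D * C a) • Matrix.single (0 : Fin (m + 1)) (0 : Fin (m + 1)) (1 : ℝ[X])).det.roots.toFinset.filter
        (fun t => 0 < t)).card ≤
      ((wronskian (G.det * (G.submatrix Fin.succ Fin.succ).det)
            (X * wronskian (G.submatrix Fin.succ Fin.succ).det G.det)).roots.toFinset.filter (fun t => 0 < t)).card +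
        4 * (G.det.roots.toFinset.filter (fun t => 0 < t)).card +
        2 * ((G.submatrix Fin.succ Fin.succ).det.roots.toFinset.filter (fun t => 0 < t)).card + 2 := by
  rw [det_add_smul_single_zero]
  have heq : G.det + (X : ℝ[X]) ^ D * C a * (G.submatrix Fin.succ Fin.succ).det =
      G.det + C a * X ^ D * (G.submatrix Fin.succ Fin.succ).det := by ring
  rw [heq]
  exact card_posRoots_twoDigit_le _ _ a D

/-- the `(0,0)`-minor of a lacunary pencil is the lacunary pencil of the minors. [folklore] -/
theorem submatrix_pencil_succ {K : ℕ} (d : Fin K → ℕ) (S : Fin K → Matrix (Fin (m + 1)) (Fin (m + 1)) ℝ) :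
    (∑ l, ((X : ℝ[X]) ^ d l) • (S l).map C).submatrix Fin.succ Fin.succ =
      ∑ l, ((X : ℝ[X]) ^ d l) • ((S l).submatrix Fin.succ Fin.succ).map C := by
  refine Matrix.ext fun i j => ?_
  simp [Matrix.submatrix_apply, Matrix.sum_apply, Matrix.smul_apply, Matrix.map_apply]

/-- ★ **CORNER GRAFT, CLASS FORM** — on ANY support `d` with `K ≥ 1` letters, if every symmetric pencil of size `m+1` on `d` has
at most `B` positive determinant zeros, then for every symmetric `G = Σₗ X^{dₗ} Sₗ` of size `m+1`, EVERY far exponent `D` and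
EVERY coupling `a`: `Z₊(det (G + a X^D·E₀₀)) ≤ Z₊(𝓘(det G, det G₀₀)) + 6·B + 2`.  No tower hypothesis, no `D > m·max d`, no
additive term in `m`: the whole `(D, a)`-family is controlled by ONE `D`-free polynomial of the `K`-letter pencil. [this work] -/
theorem card_posRoots_cornerGraft_le_inflection_class {K B : ℕ} (hK : 0 < K) (d : Fin K → ℕ)
    (hB : PosRootLawOn (m + 1) K B d) (S : Fin K → Matrix (Fin (m + 1)) (Fin (m + 1)) ℝ) (hS : ∀ l, (S l).IsSymm)
    (D : ℕ) (a : ℝ) :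
    (((∑ l, ((X : ℝ[X]) ^ d l) • (S l).map C) +
          ((X : ℝ[X]) ^ D * C a) • Matrix.single (0 : Fin (m + 1)) (0 : Fin (m + 1)) (1 : ℝ[X])).det.roots.toFinset.filter
        (fun t => 0 < t)).card ≤
      ((wronskian ((∑ l, ((X : ℝ[X]) ^ d l) • (S l).map C).det *
              ((∑ l, ((X : ℝ[X]) ^ d l) • (S l).map C).submatrix Fin.succ Fin.succ).det)
            (X * wronskian ((∑ l, ((X : ℝ[X]) ^ d l) • (S l).map C).submatrix Fin.succ Fin.succ).det
              (∑ l, ((X : ℝ[X]) ^ d l) • (S l).map C).det)).roots.toFinset.filter (fun t => 0 < t)).card +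
        6 * B + 2 := by
  have h := card_posRoots_cornerGraft_le_inflection (∑ l, ((X : ℝ[X]) ^ d l) • (S l).map C) a D
  have hA : ((∑ l, ((X : ℝ[X]) ^ d l) • (S l).map C).det.roots.toFinset.filter (fun t => 0 < t)).card ≤ B := hB S hS
  have hE : (((∑ l, ((X : ℝ[X]) ^ d l) • (S l).map C).submatrix Fin.succ Fin.succ).det.roots.toFinset.filter
      (fun t => 0 < t)).card ≤ B := by
    rw [submatrix_pencil_succ]
    exact posRootLawOn_of_succ hK hB (fun l => (S l).submatrix Fin.succ Fin.succ) (fun l => (hS l).submatrix _)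
  omega

/-- **boundedness along the far exponent** — for each fixed matrix `G` there is ONE bound `N` with
`Z₊(det (G + a X^D·E₀₀)) ≤ N` for all `D` and all `a`. [this work] -/
theorem sup_D_cornerGraft_finite (G : Matrix (Fin (m + 1)) (Fin (m + 1)) ℝ[X]) :
    ∃ N : ℕ, ∀ (D : ℕ) (a : ℝ),
      ((G + ((X : ℝ[X]) ^ D * C a) • Matrix.single (0 : Fin (m + 1)) (0 : Fin (m + 1)) (1 : ℝ[X])).det.roots.toFinset.filter
        (fun t => 0 < t)).card ≤ N :=
  ⟨_, fun D a => card_posRoots_cornerGraft_le_inflection G a D⟩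

/-! ## §4 The reduction offered to the line: an INFLECTION CLASS LAW gives the corner graft law (corner `0`, sizes `≥ 2`),
uniformly in the far exponent and the coupling -/

/-- arithmetic of the constants: `(2^C·B + 2^{C·L²}) + 6B + 2 ≤ 2^{C+3}·B + 2^{(C+3)·L²}` once `L ≥ 1`. [arithmetic] -/
theorem inflection_constants (c B L : ℕ) (hL : 1 ≤ L) :
    2 ^ c * B + 2 ^ (c * L ^ 2) + 6 * B + 2 ≤ 2 ^ (c + 3) * B + 2 ^ ((c + 3) * L ^ 2) := by
  have hL2 : 1 ≤ L ^ 2 := Nat.one_le_pow _ _ hL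
  have h1 : 2 ^ c * B + 6 * B ≤ 2 ^ (c + 3) * B := by
    have : 2 ^ c + 6 ≤ 2 ^ (c + 3) := by
      have h2 : 1 ≤ 2 ^ c := Nat.one_le_two_pow
      calc 2 ^ c + 6 ≤ 2 ^ c + 6 * 2 ^ c := by omega
        _ ≤ 8 * 2 ^ c := by omega
        _ = 2 ^ (c + 3) := by rw [pow_add]; ring
    calc 2 ^ c * B + 6 * B = (2 ^ c + 6) * B := by ring
      _ ≤ 2 ^ (c + 3) * B := Nat.mul_le_mul_right _ this
  have h2 : 2 ^ (c * L ^ 2) + 2 ≤ 2 ^ ((c + 3) * L ^ 2) := by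
    have h3 : 2 ^ (c * L ^ 2) * 4 ≤ 2 ^ ((c + 3) * L ^ 2) := by
      calc 2 ^ (c * L ^ 2) * 4 = 2 ^ (c * L ^ 2 + 2) := by rw [pow_add]; norm_num
        _ ≤ 2 ^ ((c + 3) * L ^ 2) := Nat.pow_le_pow_right (by norm_num) (by nlinarith)
    have h4 : 1 ≤ 2 ^ (c * L ^ 2) := Nat.one_le_two_pow
    omega
  omega

/-- **the reduction, explicit constant, corner `0`.**  If every symmetric `(m+1)`-pencil `G` on a support with `K ≥ 1` letters and
class budget `B` has `Z₊(𝓘(det G, det G₀₀)) ≤ 2^c·B + 2^{c·⌊log₂(m+1)⌋²}` (INFLECTION CLASS LAW with constant `c`, hypothesis), then for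
`m + 1 ≥ 2` every corner graft at `0` — EVERY far exponent `D`, EVERY coupling `a` — has at most `2^{c+3}·B + 2^{(c+3)·⌊log₂(m+1)⌋²}`
positive zeros. [this work] -/
theorem cornerGraft_le_of_inflectionClassLaw (c : ℕ)
    (hI : ∀ (m K B : ℕ) (d : Fin K → ℕ), 0 < K → PosRootLawOn (m + 1) K B d →
      ∀ (S : Fin K → Matrix (Fin (m + 1)) (Fin (m + 1)) ℝ), (∀ l, (S l).IsSymm) →
        ((wronskian ((∑ l, ((X : ℝ[X]) ^ d l) • (S l).map C).det *
              ((∑ l, ((X : ℝ[X]) ^ d l) • (S l).map C).submatrix Fin.succ Fin.succ).det)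
            (X * wronskian ((∑ l, ((X : ℝ[X]) ^ d l) • (S l).map C).submatrix Fin.succ Fin.succ).det
              (∑ l, ((X : ℝ[X]) ^ d l) • (S l).map C).det)).roots.toFinset.filter (fun t => 0 < t)).card ≤
          2 ^ c * B + 2 ^ (c * Nat.log 2 (m + 1) ^ 2))
    {m K B : ℕ} (D : ℕ) (d : Fin K → ℕ) (hK : 0 < K) (hm : 1 ≤ m) (hB : PosRootLawOn (m + 1) K B d)
    (S : Fin K → Matrix (Fin (m + 1)) (Fin (m + 1)) ℝ) (a : ℝ) (hS : ∀ l, (S l).IsSymm) :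
    (((∑ l, ((X : ℝ[X]) ^ d l) • (S l).map C) +
        ((X : ℝ[X]) ^ D * C a) • Matrix.single (0 : Fin (m + 1)) (0 : Fin (m + 1)) (1 : ℝ[X])).det.roots.toFinset.filter
      (fun t => 0 < t)).card ≤ 2 ^ (c + 3) * B + 2 ^ ((c + 3) * Nat.log 2 (m + 1) ^ 2) := by
  have h1 := card_posRoots_cornerGraft_le_inflection_class hK d hB S hS D a
  have h2 := hI m K B d hK hB S hS
  have hL : 1 ≤ Nat.log 2 (m + 1) := Nat.log_pos (by norm_num) (by omega)
  have h3 := inflection_constants c B (Nat.log 2 (m + 1)) hL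
  omega

/-- **the reduction for an ARBITRARY rank-one far letter `a·X^D·w wᵀ`** (the shapes of S4b `TowerGraftLawCorner`, `w = eᵢ`, and of
(GL-rk1) `TowerGraftLawRankOne`): a constant frame `T` with `T w = (w·w)·e₀` (the tree's `RolleSchur.exists_frame`) conjugates the
grafted pencil to a corner-`0` graft on the symmetric letters `T Sₗ Tᵀ` (same support; the tree's `frame_conj_rankOneGraft`), to which the
inflection class law applies; `det` changes by the non-zero constant `(det T)²`. [this work] -/
theorem rankOneGraft_le_of_inflectionClassLaw (c : ℕ)
    (hI : ∀ (m K B : ℕ) (d : Fin K → ℕ), 0 < K → PosRootLawOn (m + 1) K B d →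
      ∀ (S : Fin K → Matrix (Fin (m + 1)) (Fin (m + 1)) ℝ), (∀ l, (S l).IsSymm) →
        ((wronskian ((∑ l, ((X : ℝ[X]) ^ d l) • (S l).map C).det *
              ((∑ l, ((X : ℝ[X]) ^ d l) • (S l).map C).submatrix Fin.succ Fin.succ).det)
            (X * wronskian ((∑ l, ((X : ℝ[X]) ^ d l) • (S l).map C).submatrix Fin.succ Fin.succ).det
              (∑ l, ((X : ℝ[X]) ^ d l) • (S l).map C).det)).roots.toFinset.filter (fun t => 0 < t)).card ≤
          2 ^ c * B + 2 ^ (c * Nat.log 2 (m + 1) ^ 2))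
    {m K B : ℕ} (D : ℕ) (d : Fin K → ℕ) (hK : 0 < K) (hm : 1 ≤ m) (hB : PosRootLawOn (m + 1) K B d)
    (S : Fin K → Matrix (Fin (m + 1)) (Fin (m + 1)) ℝ) (a : ℝ) (w : Fin (m + 1) → ℝ) (hS : ∀ l, (S l).IsSymm) :
    (((∑ l, ((X : ℝ[X]) ^ d l) • (S l).map C) +
        ((X : ℝ[X]) ^ D * C a) • (Matrix.vecMulVec w w).map C).det.roots.toFinset.filter
      (fun t => 0 < t)).card ≤ 2 ^ (c + 3) * B + 2 ^ ((c + 3) * Nat.log 2 (m + 1) ^ 2) := by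
  by_cases hw : w = 0
  · subst hw
    have h0 : (Matrix.vecMulVec (0 : Fin (m + 1) → ℝ) (0 : Fin (m + 1) → ℝ)).map (C : ℝ →+* ℝ[X]) = 0 := by
      refine Matrix.ext fun i j => ?_
      simp
    rw [h0, smul_zero, add_zero]
    have h1 : B ≤ 2 ^ (c + 3) * B := Nat.le_mul_of_pos_left B Nat.one_le_two_pow
    have h2 : 1 ≤ 2 ^ ((c + 3) * Nat.log 2 (m + 1) ^ 2) := Nat.one_le_two_pow
    exact (hB S hS).trans (by omega)
  obtain ⟨T, hT, hTw⟩ :=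
    Summit.ValiantsHypothesis.ValiantsHypothesis.Theorems.LacunarySymmetroidMatrixDescartes.RolleSchur.exists_frame w hw
  set F := (∑ l, ((X : ℝ[X]) ^ d l) • (S l).map C) + ((X : ℝ[X]) ^ D * C a) • (Matrix.vecMulVec w w).map C with hF
  have hconj := frame_conj_rankOneGraft d S T w (w ⬝ᵥ w) hTw ((X : ℝ[X]) ^ D * C a)
  rw [← hF] at hconj
  have hdet : (T.map C * F * (T.map C)ᵀ).det = C (T.det * T.det) * F.det := by
    rw [Matrix.det_mul, Matrix.det_mul, Matrix.det_transpose, ← RingHom.mapMatrix_apply, ← RingHom.map_det]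
    rw [C_mul]; ring
  have hTT : T.det * T.det ≠ 0 := mul_ne_zero hT hT
  have hroots : F.det.roots = ((∑ l, ((X : ℝ[X]) ^ d l) • (T * S l * Tᵀ).map C) +
      (((X : ℝ[X]) ^ D * C (a * (w ⬝ᵥ w) ^ 2)) • Matrix.single (0 : Fin (m + 1)) (0 : Fin (m + 1)) (1 : ℝ[X]))).det.roots := by
    rw [← Polynomial.roots_C_mul _ hTT, ← hdet, hconj, mul_assoc, ← C_mul]
  rw [hroots]
  have hS' : ∀ l, (T * S l * Tᵀ).IsSymm := fun l => by
    unfold Matrix.IsSymm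
    rw [Matrix.transpose_mul, Matrix.transpose_mul, Matrix.transpose_transpose, (hS l).eq, ← Matrix.mul_assoc]
  exact cornerGraft_le_of_inflectionClassLaw c hI D d hK hm hB (fun l => T * S l * Tᵀ) (a * (w ⬝ᵥ w) ^ 2) hS'

/-- ★ **THE REDUCTION OFFERED TO THE LINE.**  Suppose the INFLECTION CLASS LAW: for some `c`, on every support with `K ≥ 1` letters and
every class budget `PosRootLawOn (m+1) K B d`, every symmetric `(m+1)`-pencil `G` on `d` has
`Z₊(𝓘(det G, det G₀₀)) ≤ 2^c·B + 2^{c·⌊log₂(m+1)⌋²}` (a statement about `K`-letter pencils: no graft, no far letter, no far exponent).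
Then the RANK-ONE GRAFT LAW holds with constant `c + 3` for all sizes `m + 1 ≥ 2`, for EVERY rank-one far letter `a·X^D·w wᵀ`, EVERY far
exponent `D` and EVERY coupling `a` — this is the body of S4b `TowerGraftLawCorner` (`w = eᵢ`, `a = 1`) and of (GL-rk1)
`TowerGraftLawRankOne`, with their tower and `D > m·max d` guards dropped (they are not used). [this work] -/
theorem rankOneGraft_of_inflectionClassLaw
    (hI : ∃ c : ℕ, ∀ (m K B : ℕ) (d : Fin K → ℕ), 0 < K → PosRootLawOn (m + 1) K B d →
      ∀ (S : Fin K → Matrix (Fin (m + 1)) (Fin (m + 1)) ℝ), (∀ l, (S l).IsSymm) →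
        ((wronskian ((∑ l, ((X : ℝ[X]) ^ d l) • (S l).map C).det *
              ((∑ l, ((X : ℝ[X]) ^ d l) • (S l).map C).submatrix Fin.succ Fin.succ).det)
            (X * wronskian ((∑ l, ((X : ℝ[X]) ^ d l) • (S l).map C).submatrix Fin.succ Fin.succ).det
              (∑ l, ((X : ℝ[X]) ^ d l) • (S l).map C).det)).roots.toFinset.filter (fun t => 0 < t)).card ≤
          2 ^ c * B + 2 ^ (c * Nat.log 2 (m + 1) ^ 2)) :
    ∃ c : ℕ, ∀ (m K B D : ℕ) (d : Fin K → ℕ), 0 < K → 1 ≤ m → PosRootLawOn (m + 1) K B d →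
      ∀ (S : Fin K → Matrix (Fin (m + 1)) (Fin (m + 1)) ℝ) (a : ℝ) (w : Fin (m + 1) → ℝ), (∀ l, (S l).IsSymm) →
        (((∑ l, ((X : ℝ[X]) ^ d l) • (S l).map C) +
            ((X : ℝ[X]) ^ D * C a) • (Matrix.vecMulVec w w).map C).det.roots.toFinset.filter
          (fun t => 0 < t)).card ≤ 2 ^ c * B + 2 ^ (c * Nat.log 2 (m + 1) ^ 2) := by
  obtain ⟨c, hc⟩ := hI
  exact ⟨c + 3, fun m K B D d hK hm hB S a w hS => rankOneGraft_le_of_inflectionClassLaw c hc D d hK hm hB S a w hS⟩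

/-- the corner-`0` form of the reduction (`∃ c` packaging of `cornerGraft_le_of_inflectionClassLaw`). [this work] -/
theorem cornerGraft_of_inflectionClassLaw
    (hI : ∃ c : ℕ, ∀ (m K B : ℕ) (d : Fin K → ℕ), 0 < K → PosRootLawOn (m + 1) K B d →
      ∀ (S : Fin K → Matrix (Fin (m + 1)) (Fin (m + 1)) ℝ), (∀ l, (S l).IsSymm) →
        ((wronskian ((∑ l, ((X : ℝ[X]) ^ d l) • (S l).map C).det *
              ((∑ l, ((X : ℝ[X]) ^ d l) • (S l).map C).submatrix Fin.succ Fin.succ).det)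
            (X * wronskian ((∑ l, ((X : ℝ[X]) ^ d l) • (S l).map C).submatrix Fin.succ Fin.succ).det
              (∑ l, ((X : ℝ[X]) ^ d l) • (S l).map C).det)).roots.toFinset.filter (fun t => 0 < t)).card ≤
          2 ^ c * B + 2 ^ (c * Nat.log 2 (m + 1) ^ 2)) :
    ∃ c : ℕ, ∀ (m K B D : ℕ) (d : Fin K → ℕ), 0 < K → 1 ≤ m → PosRootLawOn (m + 1) K B d →
      ∀ (S : Fin K → Matrix (Fin (m + 1)) (Fin (m + 1)) ℝ) (a : ℝ), (∀ l, (S l).IsSymm) →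
        (((∑ l, ((X : ℝ[X]) ^ d l) • (S l).map C) +
            ((X : ℝ[X]) ^ D * C a) • Matrix.single (0 : Fin (m + 1)) (0 : Fin (m + 1)) (1 : ℝ[X])).det.roots.toFinset.filter
          (fun t => 0 < t)).card ≤ 2 ^ c * B + 2 ^ (c * Nat.log 2 (m + 1) ^ 2) := by
  obtain ⟨c, hc⟩ := hI
  exact ⟨c + 3, fun m K B D d hK hm hB S a hS => cornerGraft_le_of_inflectionClassLaw c hc D d hK hm hB S a hS⟩

/-! ## §5 (rev 2) FORMAT-LOCAL form of the reduction: the inflection bound for the symmetric pencils of ONE format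
`(m+1, K)`, ONE support `d` and ONE budget `B` already gives the rank-one graft law there — for every far letter, far exponent and
coupling.  (So S4b needs the inflection class law only on the TOWER supports it quantifies over, size by size.) -/

/-- **format-local reduction, corner `0`.**  Fix a format `(m+1, K)` with `m + 1 ≥ 2`, `K ≥ 1`, a support `d` and a class budget
`PosRootLawOn (m+1) K B d`.  If every symmetric pencil `G` of this format on `d` has `Z₊(𝓘(det G, det G₀₀)) ≤ 2^c·B + 2^{c·⌊log₂(m+1)⌋²}`,
then every corner graft at `0` on such a pencil — every `D`, every `a` — has at most `2^{c+3}·B + 2^{(c+3)·⌊log₂(m+1)⌋²}` positive zeros.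
[this work] -/
theorem cornerGraft_le_of_inflectionBound_at (c : ℕ) {m K B : ℕ} (d : Fin K → ℕ) (hK : 0 < K) (hm : 1 ≤ m)
    (hB : PosRootLawOn (m + 1) K B d)
    (hI : ∀ (S : Fin K → Matrix (Fin (m + 1)) (Fin (m + 1)) ℝ), (∀ l, (S l).IsSymm) →
        ((wronskian ((∑ l, ((X : ℝ[X]) ^ d l) • (S l).map C).det *
              ((∑ l, ((X : ℝ[X]) ^ d l) • (S l).map C).submatrix Fin.succ Fin.succ).det)
            (X * wronskian ((∑ l, ((X : ℝ[X]) ^ d l) • (S l).map C).submatrix Fin.succ Fin.succ).det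
              (∑ l, ((X : ℝ[X]) ^ d l) • (S l).map C).det)).roots.toFinset.filter (fun t => 0 < t)).card ≤
          2 ^ c * B + 2 ^ (c * Nat.log 2 (m + 1) ^ 2))
    (D : ℕ) (S : Fin K → Matrix (Fin (m + 1)) (Fin (m + 1)) ℝ) (a : ℝ) (hS : ∀ l, (S l).IsSymm) :
    (((∑ l, ((X : ℝ[X]) ^ d l) • (S l).map C) +
        ((X : ℝ[X]) ^ D * C a) • Matrix.single (0 : Fin (m + 1)) (0 : Fin (m + 1)) (1 : ℝ[X])).det.roots.toFinset.filter
      (fun t => 0 < t)).card ≤ 2 ^ (c + 3) * B + 2 ^ ((c + 3) * Nat.log 2 (m + 1) ^ 2) := by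
  have h1 := card_posRoots_cornerGraft_le_inflection_class hK d hB S hS D a
  have h2 := hI S hS
  have hL : 1 ≤ Nat.log 2 (m + 1) := Nat.log_pos (by norm_num) (by omega)
  have h3 := inflection_constants c B (Nat.log 2 (m + 1)) hL
  omega

/-- **format-local reduction, arbitrary rank-one far letter `a·X^D·w wᵀ`** (same format, support and budget; the frame conjugation of
`rankOneGraft_le_of_inflectionClassLaw` stays inside the format). [this work] -/
theorem rankOneGraft_le_of_inflectionBound_at (c : ℕ) {m K B : ℕ} (d : Fin K → ℕ) (hK : 0 < K) (hm : 1 ≤ m)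
    (hB : PosRootLawOn (m + 1) K B d)
    (hI : ∀ (S : Fin K → Matrix (Fin (m + 1)) (Fin (m + 1)) ℝ), (∀ l, (S l).IsSymm) →
        ((wronskian ((∑ l, ((X : ℝ[X]) ^ d l) • (S l).map C).det *
              ((∑ l, ((X : ℝ[X]) ^ d l) • (S l).map C).submatrix Fin.succ Fin.succ).det)
            (X * wronskian ((∑ l, ((X : ℝ[X]) ^ d l) • (S l).map C).submatrix Fin.succ Fin.succ).det
              (∑ l, ((X : ℝ[X]) ^ d l) • (S l).map C).det)).roots.toFinset.filter (fun t => 0 < t)).card ≤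
          2 ^ c * B + 2 ^ (c * Nat.log 2 (m + 1) ^ 2))
    (D : ℕ) (S : Fin K → Matrix (Fin (m + 1)) (Fin (m + 1)) ℝ) (a : ℝ) (w : Fin (m + 1) → ℝ) (hS : ∀ l, (S l).IsSymm) :
    (((∑ l, ((X : ℝ[X]) ^ d l) • (S l).map C) +
        ((X : ℝ[X]) ^ D * C a) • (Matrix.vecMulVec w w).map C).det.roots.toFinset.filter
      (fun t => 0 < t)).card ≤ 2 ^ (c + 3) * B + 2 ^ ((c + 3) * Nat.log 2 (m + 1) ^ 2) := by
  by_cases hw : w = 0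
  · subst hw
    have h0 : (Matrix.vecMulVec (0 : Fin (m + 1) → ℝ) (0 : Fin (m + 1) → ℝ)).map (C : ℝ →+* ℝ[X]) = 0 := by
      refine Matrix.ext fun i j => ?_
      simp
    rw [h0, smul_zero, add_zero]
    have h1 : B ≤ 2 ^ (c + 3) * B := Nat.le_mul_of_pos_left B Nat.one_le_two_pow
    have h2 : 1 ≤ 2 ^ ((c + 3) * Nat.log 2 (m + 1) ^ 2) := Nat.one_le_two_pow
    exact (hB S hS).trans (by omega)
  obtain ⟨T, hT, hTw⟩ :=
    Summit.ValiantsHypothesis.ValiantsHypothesis.Theorems.LacunarySymmetroidMatrixDescartes.RolleSchur.exists_frame w hw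
  set F := (∑ l, ((X : ℝ[X]) ^ d l) • (S l).map C) + ((X : ℝ[X]) ^ D * C a) • (Matrix.vecMulVec w w).map C with hF
  have hconj := frame_conj_rankOneGraft d S T w (w ⬝ᵥ w) hTw ((X : ℝ[X]) ^ D * C a)
  rw [← hF] at hconj
  have hdet : (T.map C * F * (T.map C)ᵀ).det = C (T.det * T.det) * F.det := by
    rw [Matrix.det_mul, Matrix.det_mul, Matrix.det_transpose, ← RingHom.mapMatrix_apply, ← RingHom.map_det]
    rw [C_mul]; ring
  have hTT : T.det * T.det ≠ 0 := mul_ne_zero hT hT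
  have hroots : F.det.roots = ((∑ l, ((X : ℝ[X]) ^ d l) • (T * S l * Tᵀ).map C) +
      (((X : ℝ[X]) ^ D * C (a * (w ⬝ᵥ w) ^ 2)) • Matrix.single (0 : Fin (m + 1)) (0 : Fin (m + 1)) (1 : ℝ[X]))).det.roots := by
    rw [← Polynomial.roots_C_mul _ hTT, ← hdet, hconj, mul_assoc, ← C_mul]
  rw [hroots]
  have hS' : ∀ l, (T * S l * Tᵀ).IsSymm := fun l => by
    unfold Matrix.IsSymm
    rw [Matrix.transpose_mul, Matrix.transpose_mul, Matrix.transpose_transpose, (hS l).eq, ← Matrix.mul_assoc]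
  exact cornerGraft_le_of_inflectionBound_at c d hK hm hB hI D (fun l => T * S l * Tᵀ) (a * (w ⬝ᵥ w) ^ 2) hS'

end Corner

end InflectionLaw

end Summit.ValiantsHypothesis.ValiantsHypothesis.Theorems.KPlusLogSqLaw.TowerGraft
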